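/-
Copyright: the b2b-balaban T⁴-continuum CRUX team, row NE7b OWNER lineage `t4-ne7b-p1` (gen 141). Project licence.
-/
import Summits.QuantumFields.BalabanUV.T4Continuum.Spine.NE7b.SupWhitenedHessianKernelLetter
import Summits.QuantumFields.BalabanUV.T4Continuum.Spine.NE7b.SupThirdKernelEntryLetters
import Summits.QuantumFields.BalabanUV.T4Continuum.Spine.NE7b.SupKernelSchurTrilinear

/-!
# THE SECOND-ORDER BLOCK OF THE KERNEL-LETTER CLASS MAP, GENERAL `Γ = AAᵀ`, ANY ADMISSIBLE `D` (SCOPING (d13)(1), eighth file).  The INPUT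
# format at order 2 is the entrywise majorant `|U″(φ)[e_z,e_x]| ≤ Hk_{xz}` (all `φ`) with its row∕column letters `hr, hc` and the operator
# letter `‖U″‖ ≤ κ₂`.  (459) gave the OUTPUT Hessian's background-free entry majorant `|HessW(ψ)[e_x,e_y]| ≤ Hk_{yx} + E_D(b^x,b^y)`,
# `E_D(a,b) = Σ_w(Dᵀa)_w(Dᵀb)_w∕(1−lamA)`, `b^v_w = Σ_u|A_{uw}|Hk_{vu}`; so `Hk⁺_{xz} := Hk_{xz} + E_D(b^z,b^x)` IS an input-format majorant of
# the output, and with the plain letters `dr, dc` of `D`: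
#   `hr⁺ = Σ_u Hk⁺_{vu} ≤ hr + hr·αr·αc·hc·dr·dc∕(1−lamA)`,   `hc⁺ = Σ_v Hk⁺_{vu} ≤ hc + hr·αr·αc·hc·dr·dc∕(1−lamA)`,
#   the kernel row letter `Σ_y|HessW(ψ)[e_x,e_y]| ≤ hc⁺`'s bound, and the OPERATOR LETTER `‖HessW(ψ)‖ ≤ √(R_r·R_c)` READ OFF by Schur
# ((481) §1's weighted Cauchy–Schwarz) — the order-2 companion of (483): the kernel-letter class reproduces itself at orders 2 AND 3 under the
# fluctuation step with a general singular finite-range `Γ = AAᵀ`, uniformly in background and volume (row NE7b, node U5c; (459)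
# `whitened_hessian_entry_le`, (480) `two_point_symm`∕`two_point_family_sum_le`, (481) `weighted_cauchy_schwarz`, (456) BY NAME; [folklore])

Cell `pub-balaban`, sub-cell `t4`, spine estimate NE7b (`T4WeightBudget.RelWeightBound`; the cell's OWN estimate — NOT PRINTED in
[Bałaban 1983–89], NOT PROVED).  Crux-route work under `Spine/NE7b/` by the row OWNER (`t4-ne7b-p1` gen 141, file (484)) under FREEZE
(0)'s crux-prover clause; NOTHING of Bałaban's is named as a Lean object, valued or asserted; no `T4Continuum/Support` leaf typed; no
`def`, no notation (`HessW(ψ)`, `Hk⁺` WRITTEN OUT); zero `sorry`.  Imports (BY NAME): the OWNER's (459) `…SupWhitenedHessianKernelLetter`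
(`whitened_hessian_entry_le`), (480) `…SupThirdKernelEntryLetters` (`two_point_symm`, `two_point_family_sum_le`), (481) `…SupKernelSchurTrilinear`
(`weighted_cauchy_schwarz`; through it (456) `expand_two_slots`, `whitened_obs_nonneg`, `whitened_obs_rowsum_le`, `whitened_obs_colsum_le`).

WHAT IS PROVED ([folklore]):
* §1 `opNorm_le_of_row_col` (Schur at order 2, homogeneous: rows `≤ L_r`, columns `≤ L_c ⟹ ‖B‖ ≤ √(L_rL_c)`).
* §2 `two_point_increment_le` (`Σ_u E_D(b^u,b^v), Σ_v E_D(b^u,b^v) ≤ hr·αr·αc·hc·dr·dc∕(1−lamA)`), **`output_hr`**, **`output_hc`** (the letters of `Hk⁺`).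
* §3 **`output_second_entry_format`**, **`output_second_rowsum`**, `output_second_colsum`, THE END **`output_second_opNorm`**; §4 toy.

HONEST (what this is NOT).  The order-2 block; with (483) the kernel letters at orders 2–3 reproduce with explicit constants, but the
constants GROW per step before rescaling ((433), (436): the flow is NOT claimed); the one-point letters of (427) (`M ≻ 0` there) are not
repackaged; `D`, its letters and the smallness are hypotheses; orders four and five NOT typed; scalar skeleton ((A3), NC-NE7b-α UNRULED);
nothing of Bałaban's asserted.  BY-NAME EFFECT ON THE WALL: NONE.  NE7b NOT PRINTED ∕ NOT PROVED; spine PROVED 0∕9; rung (B)+1 — the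
programme's measures remain FINITE-torus statements; NOT the mass gap, NOT Clay.  HONEST DEPENDENCY: continuum YM on T⁴ ⇐ BetaPertH ∧
nine spine estimates (0∕9 proved); BetaPertH ⇐ (D1) ∧ (D4) ∧ CAP+tail; G-an2-4 gates asym, D1 and NE2∕3∕4.
-/

set_option autoImplicit false
set_option maxSynthPendingDepth 3

noncomputable section

namespace Summit.QuantumFields.BalabanUV.T4Continuum.NE7b.SupKernelClassSecondOrder

open MeasureTheory ProbabilityTheory Finset Real Matrix
open scoped BigOperators Matrix
open SupWhitenedHessianKernelLetter (whitened_hessian_entry_le)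
open SupThirdKernelEntryLetters (two_point_symm two_point_family_sum_le)
open SupKernelSchurTrilinear (weighted_cauchy_schwarz)
open SupWhitenedFirstOrderLetters (expand_two_slots whitened_obs_nonneg whitened_obs_rowsum_le whitened_obs_colsum_le)

variable {ι κ : Type} [Fintype ι] [DecidableEq ι] [Fintype κ] [DecidableEq κ]

/-! ## §1. Schur at order 2, homogeneous form -/

omit [Fintype κ] [DecidableEq κ] in
/-- **Schur at order 2**: a continuous bilinear map on `ℝ^ι` whose entries have rows `Σ_y|B[e_x,e_y]| ≤ L_r` and columns `Σ_x|B[e_x,e_y]| ≤ L_c`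
has `‖B‖ ≤ √(L_rL_c)` ((456)'s two-slot expansion, (481)'s weighted Cauchy–Schwarz). [folklore] -/
theorem opNorm_le_of_row_col (B : EuclideanSpace ℝ ι →L[ℝ] EuclideanSpace ℝ ι →L[ℝ] ℝ) {Lr Lc : ℝ}
    (hrow : ∀ x, ∑ y, |B (EuclideanSpace.single x (1 : ℝ)) (EuclideanSpace.single y (1 : ℝ))| ≤ Lr)
    (hcol : ∀ y, ∑ x, |B (EuclideanSpace.single x (1 : ℝ)) (EuclideanSpace.single y (1 : ℝ))| ≤ Lc) : ‖B‖ ≤ Real.sqrt (Lr * Lc) := by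
  have hC : 0 ≤ Real.sqrt (Lr * Lc) := Real.sqrt_nonneg _
  refine ContinuousLinearMap.opNorm_le_bound _ hC fun h => ?_
  refine ContinuousLinearMap.opNorm_le_bound _ (mul_nonneg hC (norm_nonneg _)) fun k => ?_
  rw [Real.norm_eq_abs, expand_two_slots B h k]
  have h1 : |∑ x, ∑ y, h x * k y * B (EuclideanSpace.single x (1 : ℝ)) (EuclideanSpace.single y (1 : ℝ))| ≤
      ∑ x, ∑ y, |B (EuclideanSpace.single x (1 : ℝ)) (EuclideanSpace.single y (1 : ℝ))| * |h x| * |k y| := by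
    refine (Finset.abs_sum_le_sum_abs _ _).trans (Finset.sum_le_sum fun x _ => ?_)
    refine (Finset.abs_sum_le_sum_abs _ _).trans (Finset.sum_le_sum fun y _ => ?_)
    rw [abs_mul, abs_mul]
    exact le_of_eq (by ring)
  exact h1.trans (weighted_cauchy_schwarz (fun x y => |B (EuclideanSpace.single x (1 : ℝ)) (EuclideanSpace.single y (1 : ℝ))|)
    (fun x y => abs_nonneg _) hrow hcol h k)

/-! ## §2. The letters of `Hk⁺_{xz} = Hk_{xz} + E_D(b^z, b^x)` -/

section Letters

variable {Hk : ι → ι → ℝ} {A : Matrix ι κ ℝ} {D : κ → κ → ℝ} {lamA αr αc hr hc dr dc : ℝ}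

omit [DecidableEq ι] [DecidableEq κ] in
/-- **The two-point increments**: `Σ_u E_D(b^u,b^v) ≤ hr·αr·αc·hc·dr·dc∕(1−lamA)` and `Σ_v E_D(b^u,b^v) ≤ hr·αr·αc·hc·dr·dc∕(1−lamA)`. [folklore] -/
theorem two_point_increment_le [Nonempty ι] [Nonempty κ] (hHk0 : ∀ v u, 0 ≤ Hk v u) (hαr : ∀ u, ∑ w, |A u w| ≤ αr) (hαc : ∀ w, ∑ u, |A u w| ≤ αc)
    (hhr : ∀ v, ∑ u, Hk v u ≤ hr) (hhc : ∀ u, ∑ v, Hk v u ≤ hc) (hlam1 : lamA < 1) (hD : ∀ x y, 0 ≤ D x y) (hDr : ∀ z, ∑ w, D z w ≤ dr)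
    (hDc : ∀ w, ∑ z, D z w ≤ dc) (v : ι) :
    (∑ u', ∑ w, (∑ z', D z' w * ∑ u, |A u z'| * Hk u' u) * (∑ z', D z' w * ∑ u, |A u z'| * Hk v u) / (1 - lamA)) ≤ hr * αr * (αc * hc) * dr * dc / (1
        - lamA) ∧
      (∑ u', ∑ w, (∑ z', D z' w * ∑ u, |A u z'| * Hk v u) * (∑ z', D z' w * ∑ u, |A u z'| * Hk u' u) / (1 - lamA)) ≤ hr * αr * (αc * hc) * dr * dc /
          (1 - lamA) := by
  obtain ⟨w₀⟩ := ‹Nonempty κ›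
  have hc0 : 0 < 1 - lamA := by linarith
  have hbc0 : 0 ≤ αc * hc := le_trans (Finset.sum_nonneg fun r _ => whitened_obs_nonneg hHk0 A r w₀) (whitened_obs_colsum_le hHk0 hαc hhc w₀)
  have hdr0 : 0 ≤ dr := le_trans (Finset.sum_nonneg fun w _ => hD w₀ w) (hDr w₀)
  have hdc0 : 0 ≤ dc := le_trans (Finset.sum_nonneg fun z _ => hD z w₀) (hDc w₀)
  have hK : 0 ≤ αc * hc * dr * dc / (1 - lamA) := by positivity
  have h2 : (∑ u', ∑ w, (∑ z', D z' w * ∑ u, |A u z'| * Hk v u) * (∑ z', D z' w * ∑ u, |A u z'| * Hk u' u) / (1 - lamA)) ≤ hr * αr * (αc * hc) * dr *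
      dc / (1 - lamA) := by
    calc (∑ u', ∑ w, (∑ z', D z' w * ∑ u, |A u z'| * Hk v u) * (∑ z', D z' w * ∑ u, |A u z'| * Hk u' u) / (1 - lamA)) ≤ (∑ z', ∑ u, |A u z'| * Hk v
        u) * (αc * hc) * dr * dc / (1 - lamA) :=
          two_point_family_sum_le (a := fun z' => ∑ u, |A u z'| * Hk v u) (bf := fun r z' => ∑ u, |A u z'| * Hk r u) hD hDr hDc hc0
            (fun z' => whitened_obs_nonneg hHk0 A v z') (fun r z' => whitened_obs_nonneg hHk0 A r z') (fun z' => whitened_obs_colsum_le hHk0 hαc hhc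
                z')
      _ = (∑ z', ∑ u, |A u z'| * Hk v u) * (αc * hc * dr * dc / (1 - lamA)) := by ring
      _ ≤ hr * αr * (αc * hc * dr * dc / (1 - lamA)) := mul_le_mul_of_nonneg_right (whitened_obs_rowsum_le hHk0 hαr hhr v) hK
      _ = hr * αr * (αc * hc) * dr * dc / (1 - lamA) := by ring
  refine ⟨?_, h2⟩
  have e : ∀ u', ∑ w, (∑ z', D z' w * ∑ u, |A u z'| * Hk u' u) * (∑ z', D z' w * ∑ u, |A u z'| * Hk v u) / (1 - lamA) = ∑ w, (∑ z', D z' w * ∑ u, |A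
      u z'| * Hk v u) * (∑ z', D z' w * ∑ u, |A u z'| * Hk u' u) / (1 - lamA) := fun u' => two_point_symm _ _ D (1 - lamA)
  simp_rw [e]
  exact h2

omit [DecidableEq ι] [DecidableEq κ] in
/-- **`hr⁺`**: `Σ_u Hk⁺_{vu} = Σ_u (Hk_{vu} + E_D(b^u,b^v)) ≤ hr + hr·αr·αc·hc·dr·dc∕(1−lamA)`. [folklore] -/
theorem output_hr [Nonempty ι] [Nonempty κ] (hHk0 : ∀ v u, 0 ≤ Hk v u) (hαr : ∀ u, ∑ w, |A u w| ≤ αr) (hαc : ∀ w, ∑ u, |A u w| ≤ αc)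
    (hhr : ∀ v, ∑ u, Hk v u ≤ hr) (hhc : ∀ u, ∑ v, Hk v u ≤ hc) (hlam1 : lamA < 1) (hD : ∀ x y, 0 ≤ D x y) (hDr : ∀ z, ∑ w, D z w ≤ dr)
    (hDc : ∀ w, ∑ z, D z w ≤ dc) (v : ι) :
    ∑ u', (Hk v u' + ∑ w, (∑ z', D z' w * ∑ u, |A u z'| * Hk u' u) * (∑ z', D z' w * ∑ u, |A u z'| * Hk v u) / (1 - lamA)) ≤ hr + hr * αr * (αc * hc)
        * dr * dc / (1 - lamA) := by
  rw [Finset.sum_add_distrib]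
  exact add_le_add (hhr v) (two_point_increment_le hHk0 hαr hαc hhr hhc hlam1 hD hDr hDc v).1

omit [DecidableEq ι] [DecidableEq κ] in
/-- **`hc⁺`**: `Σ_v Hk⁺_{vu} = Σ_v (Hk_{vu} + E_D(b^u,b^v)) ≤ hc + hr·αr·αc·hc·dr·dc∕(1−lamA)`. [folklore] -/
theorem output_hc [Nonempty ι] [Nonempty κ] (hHk0 : ∀ v u, 0 ≤ Hk v u) (hαr : ∀ u, ∑ w, |A u w| ≤ αr) (hαc : ∀ w, ∑ u, |A u w| ≤ αc)
    (hhr : ∀ v, ∑ u, Hk v u ≤ hr) (hhc : ∀ u, ∑ v, Hk v u ≤ hc) (hlam1 : lamA < 1) (hD : ∀ x y, 0 ≤ D x y) (hDr : ∀ z, ∑ w, D z w ≤ dr)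
    (hDc : ∀ w, ∑ z, D z w ≤ dc) (u' : ι) :
    ∑ v, (Hk v u' + ∑ w, (∑ z', D z' w * ∑ u, |A u z'| * Hk u' u) * (∑ z', D z' w * ∑ u, |A u z'| * Hk v u) / (1 - lamA)) ≤ hc + hr * αr * (αc * hc)
        * dr * dc / (1 - lamA) := by
  rw [Finset.sum_add_distrib]
  exact add_le_add (hhc u') (two_point_increment_le hHk0 hαr hαc hhr hhc hlam1 hD hDr hDc u').2

end Letters

/-! ## §3. The output in the input's order-2 format; THE END: the operator letter -/

section TheEnd

variable {U : EuclideanSpace ℝ ι → ℝ} {U' : EuclideanSpace ℝ ι → EuclideanSpace ℝ ι →L[ℝ] ℝ}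
  {U'' : EuclideanSpace ℝ ι → EuclideanSpace ℝ ι →L[ℝ] EuclideanSpace ℝ ι →L[ℝ] ℝ} {Hk : ι → ι → ℝ} {A : Matrix ι κ ℝ} {D : κ → κ → ℝ}
  {γop κ₀ κ₁ κ₂ a τ δ θ lamA αr αc hr hc γ dr dc : ℝ}

/-- **THE OUTPUT IN THE INPUT'S ENTRY FORMAT (order 2)**: `|HessW(ψ)[e_z,e_x]| ≤ Hk⁺_{xz} = Hk_{xz} + E_D(b^z,b^x)` for every `ψ` ((459) with the
slots named as in `hHk`). [folklore] -/
theorem output_second_entry_format [Nonempty κ] (hΓop : (γop • (1 : Matrix ι ι ℝ) - A * Aᵀ).PosSemidef) (Y : Finset ι)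
    (hUd : ∀ φ : EuclideanSpace ℝ ι, HasFDerivAt U (U' φ) φ) (hU'd : ∀ φ : EuclideanSpace ℝ ι, HasFDerivAt U' (U'' φ) φ)
    (hU''c : Continuous U'') (hκ₀ : 0 ≤ κ₀) (hκ₁ : 0 ≤ κ₁) (ha : 0 ≤ a) (hκ₂ : 0 ≤ κ₂) (hτ : 0 < τ) (hδ : 0 < δ) (hθ0 : 0 < θ) (hθ1 : θ < 1)
    (hκθ : (2 * κ₀ * (1 + τ) + 4 * δ) * γop ≤ θ) (hκθw : 2 * κ₀ * (1 + τ) * γop + 4 * δ ≤ θ)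
    (hstab : ∀ φ : EuclideanSpace ℝ ι, -(κ₀ * ∑ x ∈ Y, φ x ^ 2) ≤ U φ)
    (hU'b : ∀ φ : EuclideanSpace ℝ ι, ‖U' φ‖ ≤ κ₁ * (a + ∑ x ∈ Y, φ x ^ 2)) (hU''b : ∀ φ : EuclideanSpace ℝ ι, ‖U'' φ‖ ≤ κ₂)
    (hHk : ∀ (φ : EuclideanSpace ℝ ι) (x z : ι), |U'' φ (EuclideanSpace.single z (1 : ℝ)) (EuclideanSpace.single x (1 : ℝ))| ≤ Hk x z)
    (hHk0 : ∀ v u, 0 ≤ Hk v u) (ψ : EuclideanSpace ℝ ι)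
    (hαr : ∀ u, ∑ w, |A u w| ≤ αr) (hαc : ∀ w, ∑ u, |A u w| ≤ αc) (hhr : ∀ v, ∑ u, Hk v u ≤ hr)
    (hlam : ∀ x : κ, ∑ u, ∑ v, |A u x| * |A v x| * Hk v u ≤ lamA) (hlam1 : lamA < 1) (hγ : αc * hr * αr / (1 - lamA) ≤ γ) (hγ1 : γ < 1)
    (hD : ∀ x y, 0 ≤ D x y)
    (hDC : ∀ x y, (if x = y then (1 : ℝ) else 0) + ∑ z, D x z * ((if y = z then 0 else ∑ u, ∑ v, |A u y| * |A v z| * Hk v u) / (1 - lamA)) ≤ D x y)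
        (x z : ι) :
    |((∫ ω : EuclideanSpace ℝ ι, exp (-U (ω + ψ)) ∂(multivariateGaussian 0 (A * Aᵀ)))⁻¹ • (∫ ω : EuclideanSpace ℝ ι, exp (-U (ω + ψ)) • (U'' (ω + ψ)
        - (U' (ω + ψ)).smulRight (U' (ω + ψ))) ∂(multivariateGaussian 0 (A * Aᵀ))) + (((∫ ω : EuclideanSpace ℝ ι, exp (-U (ω + ψ))
        ∂(multivariateGaussian 0 (A * Aᵀ))) ^ 2)⁻¹ • ∫ ω : EuclideanSpace ℝ ι, exp (-U (ω + ψ)) • U' (ω + ψ) ∂(multivariateGaussian 0 (A *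
        Aᵀ))).smulRight (∫ ω : EuclideanSpace ℝ ι, exp (-U (ω + ψ)) • U' (ω + ψ) ∂(multivariateGaussian 0 (A * Aᵀ)))) (EuclideanSpace.single z (1 :
        ℝ)) (EuclideanSpace.single x (1 : ℝ))| ≤ Hk x z + ∑ w, (∑ z', D z' w * ∑ u, |A u z'| * Hk z u) * (∑ z', D z' w * ∑ u, |A u z'| * Hk x u) / (1
        - lamA) :=
  whitened_hessian_entry_le hΓop Y hUd hU'd hU''c hκ₀ hκ₁ ha hκ₂ hτ hδ hθ0 hθ1 hκθ hκθw hstab hU'b hU''b hHk hHk0 ψ hαr hαc hhr hlam hlam1 hγ hγ1 hD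
      hDC z x

/-- **THE OUTPUT KERNEL ROW LETTER (order 2)**: `Σ_y|HessW(ψ)[e_x,e_y]| ≤ hc + hr·αr·αc·hc·dr·dc∕(1−lamA)` for every `ψ, x`. [folklore] -/
theorem output_second_rowsum [Nonempty κ] (hΓop : (γop • (1 : Matrix ι ι ℝ) - A * Aᵀ).PosSemidef) (Y : Finset ι)
    (hUd : ∀ φ : EuclideanSpace ℝ ι, HasFDerivAt U (U' φ) φ) (hU'd : ∀ φ : EuclideanSpace ℝ ι, HasFDerivAt U' (U'' φ) φ)
    (hU''c : Continuous U'') (hκ₀ : 0 ≤ κ₀) (hκ₁ : 0 ≤ κ₁) (ha : 0 ≤ a) (hκ₂ : 0 ≤ κ₂) (hτ : 0 < τ) (hδ : 0 < δ) (hθ0 : 0 < θ) (hθ1 : θ < 1)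
    (hκθ : (2 * κ₀ * (1 + τ) + 4 * δ) * γop ≤ θ) (hκθw : 2 * κ₀ * (1 + τ) * γop + 4 * δ ≤ θ)
    (hstab : ∀ φ : EuclideanSpace ℝ ι, -(κ₀ * ∑ x ∈ Y, φ x ^ 2) ≤ U φ)
    (hU'b : ∀ φ : EuclideanSpace ℝ ι, ‖U' φ‖ ≤ κ₁ * (a + ∑ x ∈ Y, φ x ^ 2)) (hU''b : ∀ φ : EuclideanSpace ℝ ι, ‖U'' φ‖ ≤ κ₂)
    (hHk : ∀ (φ : EuclideanSpace ℝ ι) (x z : ι), |U'' φ (EuclideanSpace.single z (1 : ℝ)) (EuclideanSpace.single x (1 : ℝ))| ≤ Hk x z)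
    (hHk0 : ∀ v u, 0 ≤ Hk v u) (ψ : EuclideanSpace ℝ ι)
    (hαr : ∀ u, ∑ w, |A u w| ≤ αr) (hαc : ∀ w, ∑ u, |A u w| ≤ αc) (hhr : ∀ v, ∑ u, Hk v u ≤ hr)
    (hlam : ∀ x : κ, ∑ u, ∑ v, |A u x| * |A v x| * Hk v u ≤ lamA) (hlam1 : lamA < 1) (hγ : αc * hr * αr / (1 - lamA) ≤ γ) (hγ1 : γ < 1)
    (hD : ∀ x y, 0 ≤ D x y)
    (hDC : ∀ x y, (if x = y then (1 : ℝ) else 0) + ∑ z, D x z * ((if y = z then 0 else ∑ u, ∑ v, |A u y| * |A v z| * Hk v u) / (1 - lamA)) ≤ D x y)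
        (hhc : ∀ u, ∑ v, Hk v u ≤ hc) (hDr : ∀ z, ∑ w, D z w ≤ dr) (hDc : ∀ w, ∑ z, D z w ≤ dc) (x : ι) :
    ∑ y, |((∫ ω : EuclideanSpace ℝ ι, exp (-U (ω + ψ)) ∂(multivariateGaussian 0 (A * Aᵀ)))⁻¹ • (∫ ω : EuclideanSpace ℝ ι, exp (-U (ω + ψ)) • (U'' (ω
        + ψ) - (U' (ω + ψ)).smulRight (U' (ω + ψ))) ∂(multivariateGaussian 0 (A * Aᵀ))) + (((∫ ω : EuclideanSpace ℝ ι, exp (-U (ω + ψ))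
        ∂(multivariateGaussian 0 (A * Aᵀ))) ^ 2)⁻¹ • ∫ ω : EuclideanSpace ℝ ι, exp (-U (ω + ψ)) • U' (ω + ψ) ∂(multivariateGaussian 0 (A *
        Aᵀ))).smulRight (∫ ω : EuclideanSpace ℝ ι, exp (-U (ω + ψ)) • U' (ω + ψ) ∂(multivariateGaussian 0 (A * Aᵀ)))) (EuclideanSpace.single x (1 :
        ℝ)) (EuclideanSpace.single y (1 : ℝ))| ≤ hc + hr * αr * (αc * hc) * dr * dc / (1 - lamA) := by
  haveI : Nonempty ι := ⟨x⟩
  refine le_trans (Finset.sum_le_sum fun y _ => whitened_hessian_entry_le hΓop Y hUd hU'd hU''c hκ₀ hκ₁ ha hκ₂ hτ hδ hθ0 hθ1 hκθ hκθw hstab hU'b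
      hU''b hHk hHk0 ψ hαr hαc hhr hlam hlam1 hγ hγ1 hD hDC x y) ?_
  exact output_hc hHk0 hαr hαc hhr hhc hlam1 hD hDr hDc x

/-- **The output kernel column letter (order 2)**: `Σ_x|HessW(ψ)[e_x,e_y]| ≤ hr + hr·αr·αc·hc·dr·dc∕(1−lamA)`. [folklore] -/
theorem output_second_colsum [Nonempty κ] (hΓop : (γop • (1 : Matrix ι ι ℝ) - A * Aᵀ).PosSemidef) (Y : Finset ι)
    (hUd : ∀ φ : EuclideanSpace ℝ ι, HasFDerivAt U (U' φ) φ) (hU'd : ∀ φ : EuclideanSpace ℝ ι, HasFDerivAt U' (U'' φ) φ)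
    (hU''c : Continuous U'') (hκ₀ : 0 ≤ κ₀) (hκ₁ : 0 ≤ κ₁) (ha : 0 ≤ a) (hκ₂ : 0 ≤ κ₂) (hτ : 0 < τ) (hδ : 0 < δ) (hθ0 : 0 < θ) (hθ1 : θ < 1)
    (hκθ : (2 * κ₀ * (1 + τ) + 4 * δ) * γop ≤ θ) (hκθw : 2 * κ₀ * (1 + τ) * γop + 4 * δ ≤ θ)
    (hstab : ∀ φ : EuclideanSpace ℝ ι, -(κ₀ * ∑ x ∈ Y, φ x ^ 2) ≤ U φ)
    (hU'b : ∀ φ : EuclideanSpace ℝ ι, ‖U' φ‖ ≤ κ₁ * (a + ∑ x ∈ Y, φ x ^ 2)) (hU''b : ∀ φ : EuclideanSpace ℝ ι, ‖U'' φ‖ ≤ κ₂)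
    (hHk : ∀ (φ : EuclideanSpace ℝ ι) (x z : ι), |U'' φ (EuclideanSpace.single z (1 : ℝ)) (EuclideanSpace.single x (1 : ℝ))| ≤ Hk x z)
    (hHk0 : ∀ v u, 0 ≤ Hk v u) (ψ : EuclideanSpace ℝ ι)
    (hαr : ∀ u, ∑ w, |A u w| ≤ αr) (hαc : ∀ w, ∑ u, |A u w| ≤ αc) (hhr : ∀ v, ∑ u, Hk v u ≤ hr)
    (hlam : ∀ x : κ, ∑ u, ∑ v, |A u x| * |A v x| * Hk v u ≤ lamA) (hlam1 : lamA < 1) (hγ : αc * hr * αr / (1 - lamA) ≤ γ) (hγ1 : γ < 1)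
    (hD : ∀ x y, 0 ≤ D x y)
    (hDC : ∀ x y, (if x = y then (1 : ℝ) else 0) + ∑ z, D x z * ((if y = z then 0 else ∑ u, ∑ v, |A u y| * |A v z| * Hk v u) / (1 - lamA)) ≤ D x y)
        (hhc : ∀ u, ∑ v, Hk v u ≤ hc) (hDr : ∀ z, ∑ w, D z w ≤ dr) (hDc : ∀ w, ∑ z, D z w ≤ dc) (y : ι) :
    ∑ x, |((∫ ω : EuclideanSpace ℝ ι, exp (-U (ω + ψ)) ∂(multivariateGaussian 0 (A * Aᵀ)))⁻¹ • (∫ ω : EuclideanSpace ℝ ι, exp (-U (ω + ψ)) • (U'' (ω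
        + ψ) - (U' (ω + ψ)).smulRight (U' (ω + ψ))) ∂(multivariateGaussian 0 (A * Aᵀ))) + (((∫ ω : EuclideanSpace ℝ ι, exp (-U (ω + ψ))
        ∂(multivariateGaussian 0 (A * Aᵀ))) ^ 2)⁻¹ • ∫ ω : EuclideanSpace ℝ ι, exp (-U (ω + ψ)) • U' (ω + ψ) ∂(multivariateGaussian 0 (A *
        Aᵀ))).smulRight (∫ ω : EuclideanSpace ℝ ι, exp (-U (ω + ψ)) • U' (ω + ψ) ∂(multivariateGaussian 0 (A * Aᵀ)))) (EuclideanSpace.single x (1 :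
        ℝ)) (EuclideanSpace.single y (1 : ℝ))| ≤ hr + hr * αr * (αc * hc) * dr * dc / (1 - lamA) := by
  haveI : Nonempty ι := ⟨y⟩
  refine le_trans (Finset.sum_le_sum fun x _ => whitened_hessian_entry_le hΓop Y hUd hU'd hU''c hκ₀ hκ₁ ha hκ₂ hτ hδ hθ0 hθ1 hκθ hκθw hstab hU'b
      hU''b hHk hHk0 ψ hαr hαc hhr hlam hlam1 hγ hγ1 hD hDC x y) ?_
  rw [Finset.sum_add_distrib]
  exact add_le_add (hhr y) (two_point_increment_le hHk0 hαr hαc hhr hhc hlam1 hD hDr hDc y).1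

/-- **THE END — THE OUTPUT OPERATOR LETTER `κ₂⁺` (order 2)**: `‖HessW(ψ)‖ ≤ √((hc + R)(hr + R))`, `R = hr·αr·αc·hc·dr·dc∕(1−lamA)`, for every
background `ψ` — READ OFF the kernel letters by Schur. [folklore] -/
theorem output_second_opNorm [Nonempty κ] (hΓop : (γop • (1 : Matrix ι ι ℝ) - A * Aᵀ).PosSemidef) (Y : Finset ι)
    (hUd : ∀ φ : EuclideanSpace ℝ ι, HasFDerivAt U (U' φ) φ) (hU'd : ∀ φ : EuclideanSpace ℝ ι, HasFDerivAt U' (U'' φ) φ)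
    (hU''c : Continuous U'') (hκ₀ : 0 ≤ κ₀) (hκ₁ : 0 ≤ κ₁) (ha : 0 ≤ a) (hκ₂ : 0 ≤ κ₂) (hτ : 0 < τ) (hδ : 0 < δ) (hθ0 : 0 < θ) (hθ1 : θ < 1)
    (hκθ : (2 * κ₀ * (1 + τ) + 4 * δ) * γop ≤ θ) (hκθw : 2 * κ₀ * (1 + τ) * γop + 4 * δ ≤ θ)
    (hstab : ∀ φ : EuclideanSpace ℝ ι, -(κ₀ * ∑ x ∈ Y, φ x ^ 2) ≤ U φ)
    (hU'b : ∀ φ : EuclideanSpace ℝ ι, ‖U' φ‖ ≤ κ₁ * (a + ∑ x ∈ Y, φ x ^ 2)) (hU''b : ∀ φ : EuclideanSpace ℝ ι, ‖U'' φ‖ ≤ κ₂)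
    (hHk : ∀ (φ : EuclideanSpace ℝ ι) (x z : ι), |U'' φ (EuclideanSpace.single z (1 : ℝ)) (EuclideanSpace.single x (1 : ℝ))| ≤ Hk x z)
    (hHk0 : ∀ v u, 0 ≤ Hk v u) (ψ : EuclideanSpace ℝ ι)
    (hαr : ∀ u, ∑ w, |A u w| ≤ αr) (hαc : ∀ w, ∑ u, |A u w| ≤ αc) (hhr : ∀ v, ∑ u, Hk v u ≤ hr)
    (hlam : ∀ x : κ, ∑ u, ∑ v, |A u x| * |A v x| * Hk v u ≤ lamA) (hlam1 : lamA < 1) (hγ : αc * hr * αr / (1 - lamA) ≤ γ) (hγ1 : γ < 1)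
    (hD : ∀ x y, 0 ≤ D x y)
    (hDC : ∀ x y, (if x = y then (1 : ℝ) else 0) + ∑ z, D x z * ((if y = z then 0 else ∑ u, ∑ v, |A u y| * |A v z| * Hk v u) / (1 - lamA)) ≤ D x y)
        (hhc : ∀ u, ∑ v, Hk v u ≤ hc) (hDr : ∀ z, ∑ w, D z w ≤ dr) (hDc : ∀ w, ∑ z, D z w ≤ dc) :
    ‖((∫ ω : EuclideanSpace ℝ ι, exp (-U (ω + ψ)) ∂(multivariateGaussian 0 (A * Aᵀ)))⁻¹ • (∫ ω : EuclideanSpace ℝ ι, exp (-U (ω + ψ)) • (U'' (ω + ψ)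
        - (U' (ω + ψ)).smulRight (U' (ω + ψ))) ∂(multivariateGaussian 0 (A * Aᵀ))) + (((∫ ω : EuclideanSpace ℝ ι, exp (-U (ω + ψ))
        ∂(multivariateGaussian 0 (A * Aᵀ))) ^ 2)⁻¹ • ∫ ω : EuclideanSpace ℝ ι, exp (-U (ω + ψ)) • U' (ω + ψ) ∂(multivariateGaussian 0 (A *
        Aᵀ))).smulRight (∫ ω : EuclideanSpace ℝ ι, exp (-U (ω + ψ)) • U' (ω + ψ) ∂(multivariateGaussian 0 (A * Aᵀ))))‖ ≤
      Real.sqrt ((hc + hr * αr * (αc * hc) * dr * dc / (1 - lamA)) * (hr + hr * αr * (αc * hc) * dr * dc / (1 - lamA))) :=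
  opNorm_le_of_row_col _ (fun x => output_second_rowsum hΓop Y hUd hU'd hU''c hκ₀ hκ₁ ha hκ₂ hτ hδ hθ0 hθ1 hκθ hκθw hstab hU'b hU''b hHk hHk0 ψ hαr
      hαc hhr hlam hlam1 hγ hγ1 hD hDC hhc hDr hDc x)
    (fun y => output_second_colsum hΓop Y hUd hU'd hU''c hκ₀ hκ₁ ha hκ₂ hτ hδ hθ0 hθ1 hκθ hκθw hstab hU'b hU''b hHk hHk0 ψ hαr hαc hhr hlam hlam1 hγ
        hγ1 hD hDC hhc hDr hDc y)

end TheEnd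

/-! ## §4. Toy -/

/-- Toy (§1 at `ι = Fin 1`, the zero form): rows and columns `≤ 0` give `‖0‖ ≤ √(0·0)`. -/
example : ‖(0 : EuclideanSpace ℝ (Fin 1) →L[ℝ] EuclideanSpace ℝ (Fin 1) →L[ℝ] ℝ)‖ ≤ Real.sqrt (0 * 0) :=
  opNorm_le_of_row_col 0 (fun x => by simp) (fun y => by simp)

end Summit.QuantumFields.BalabanUV.T4Continuum.NE7b.SupKernelClassSecondOrder

end
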